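import Mathlib
import HarnessLib
import Summits.QuantumAdvantage.Statement
import Literature.Computability.QuantumComplexity.PauliExpansion
import Literature.NumberTheory.GaussSums.SubgroupExponentialSums

/-!
# Ideator-3 sketch — crux `DeqThesis` (stmt-QuantumAdvantage-0242, X := BQP ⊆ BPP)

First lemmas of the two crux idea cards filed by planner-cruxidea-stmt-QuantumAdvantage-0242-3-0
(round 1). Nothing here is proved; every `def … : Prop` must elaborate (lean check rc 0).

* Card `parity-of-powers-hankel` (Heisenberg / two-sided time-slice road, killed on Shor's
  exponent register by Pólya–Vinogradov-type twisted subgroup sums): `TwistedSubgroupSum`,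
  `ParityPowerFlat`, `ParityHankelFarFromLowRank`.
* Card `doped-frame-budget` (free-frame road with a magic budget on the frame, killed by a doped
  purity bound): `DopedFrameBound`.
-/

noncomputable section

namespace Summit.QuantumAdvantage.QuantumAdvantage.Cruxes.DeqThesis.Ideator3

open scoped BigOperators
open Literature.Computability.QuantumComplexity Literature.Computability.Cryptography

/-- The logical status of the crux: `DeqThesis` (= `FFThesis` = `PPThesis` = …, the shared decl
`BQP ⊆ BPP`) is literally the negation of the summit statement. One line each way; recorded so
that every card can say which side it serves. -/
theorem deqThesis_iff_not_summit :
    (Literature.Computability.Cryptography.BQP ⊆ Literature.Computability.Complexity.BPP) ↔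
      ¬ _root_.QuantumAdvantage := by
  constructor
  · rintro h ⟨L, hq, hn⟩
    exact hn (h hq)
  · intro h L hL
    by_contra hn
    exact h ⟨L, hL, hn⟩

/-! ### Card 1 — parity of powers is spectrally flat -/

/-- ENGINE (twisted form of the in-tree `subgroupExpSum_norm_le_sqrt`, KS99 Thm 3.4 (3.15)):
for a unit `a` of order `r` modulo `m`, a unit frequency `α` and ANY additive twist `k` of the
exponent, `|∑_{j<r} e_m(α a^j) e(k j / r)| ≤ √m`. Same Parseval proof as the untwisted tree
theorem (the twist is a character of `⟨a⟩`, invariant up to a unimodular factor under `j ↦ j+1`). -/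
def TwistedSubgroupSum : Prop :=
  ∀ (m : ℕ) [NeZero m] (a α : ZMod m), IsUnit a → IsUnit α → ∀ k : ℕ,
    ‖∑ j ∈ Finset.range (orderOf a),
        ZMod.stdAddChar (α * a ^ j) *
          Complex.exp (2 * Real.pi * Complex.I * (k : ℂ) * (j : ℂ) / (orderOf a : ℂ))‖
      ≤ Real.sqrt m

/-- The ±1 "parity of powers" sequence of a unit `g` mod `p`: `s(j) = (−1)^{(g^j mod p) mod 2}`
(least significant bit of the least non-negative residue). -/
def paritySeq (p : ℕ) (g : ZMod p) (j : ℕ) : ℂ :=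
  if (g ^ j).val % 2 = 1 then -1 else 1

/-- KILL CORE A (provable now from `TwistedSubgroupSum` + the `O(log p)` Fourier-ℓ¹ mass of the
indicator of the odd residues): for an odd prime `p` and a unit `g` of order `r`, EVERY Fourier
coefficient over `ℤ/r` of the parity-of-powers sequence is square-root small:
`|∑_{j<r} s(j) e(−k j/r)| ≤ 2 √p (log p + 2)` for all `k` (including `k = 0` when `g` is a
primitive root, where the sum is exactly `0`; for a proper subgroup the `k = 0` term is the bias of
odd elements in `⟨g⟩`, bounded the same way). -/
def ParityPowerFlat : Prop :=
  ∀ (p : ℕ), p.Prime → p ≠ 2 → ∀ g : ZMod p, g ≠ 0 → ∀ k : ℕ,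
    ‖∑ j ∈ Finset.range (orderOf g),
        paritySeq p g j * Complex.exp (-(2 * Real.pi * Complex.I * (k : ℂ) * (j : ℂ) / (orderOf g : ℂ)))‖
      ≤ 2 * Real.sqrt p * (Real.log p + 2)

/-- The parity-of-powers HANKEL matrix over `ℤ/r` (`r = ord_p g`): `K(i,j) = s(i + j)`. It is the
`y = 1` block, dephased, of Shor's Heisenberg-evolved parity observable
`MODEXP_g† (I ⊗ Z_lsb) MODEXP_g` written across the low/high cut of the exponent register, and
(equivalently) the coefficient matrix of the phase state `∑_x s(x)|x⟩` left on the exponent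
register by phase kick-back. -/
def parityHankel (p : ℕ) (g : ZMod p) : Matrix (Fin (orderOf g)) (Fin (orderOf g)) ℂ :=
  fun i j => paritySeq p g (i.val + j.val)

/-- KILL CORE B (provable now from A: the singular values of a Hankel matrix over a cyclic group are
the moduli of the DFT of its symbol; then `‖K − B‖_F² ≥ ‖K‖_F² − rank(B)·σ_max(K)²`, an
elementary consequence of the SVD of `B` — no Eckart–Young needed): every matrix of rank `≤ t`
misses the parity Hankel matrix by `r² − t·(2√p (log p + 2))²` in squared Frobenius norm. Hence
ε-approximate rank (relative Frobenius error ≤ 1/2) of `K` is ≥ `r² /(8 p (log p + 2)²)` =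
`2^{(1−o(1)) n}` whenever `r = ord_p g ≥ p^{1−o(1)}` — exponential operator-Schmidt rank of Shor's
Heisenberg parity observable and exponential Schmidt rank of the kicked-back phase state at the
exponent mid-cut (circuit-level corollaries lose a factor `2^{v₂(r)}` at significance cuts). -/
def ParityHankelFarFromLowRank : Prop :=
  ∀ (p : ℕ), p.Prime → p ≠ 2 → ∀ g : ZMod p, g ≠ 0 → ∀ (t : ℕ)
    (B : Matrix (Fin (orderOf g)) (Fin (orderOf g)) ℂ), B.rank ≤ t →
      ((orderOf g : ℝ) ^ 2 - t * (2 * Real.sqrt p * (Real.log p + 2)) ^ 2)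
        ≤ ∑ i, ∑ j, ‖parityHankel p g i j - B i j‖ ^ 2

/-! ### Card 2 — a magic budget for the frame -/

/-- `D`-sparse frames (semantic): a unitary `U` on `N` wires whose conjugation maps EVERY Pauli
string into the span of at most `D` Pauli strings. `D = 1` is exactly the Clifford frames of
`SymplecticPurityBound` (items 10729/9835); a Clifford circuit doped with `k` T-gates (or any `k`
single-qubit gates) is `4^k`-sparse (`2^k` for diagonal dopants such as `T`). -/
def IsSparseFrame (N D : ℕ) (U : Matrix (QReg N) (QReg N) ℂ) : Prop :=
  U ∈ Matrix.unitaryGroup (QReg N) ℂ ∧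
    ∀ S : Fin N → Pauli, ∃ F : Finset (Fin N → Pauli), F.card ≤ D ∧
      U * pauliString S * star U ∈ Submodule.span ℂ (pauliString '' (F : Set (Fin N → Pauli)))

/-- DOPED FRAME BOUND (conjectural strengthening of `SymplecticPurityBound`, constant to be fixed):
an ε-flat `ψ` with any number of `|0⟩` ancillas keeps, in every `D`-sparse frame, a LINEAR cut of
purity `≤ 4·D·ε`. For `D = 2^k` this says a disentangling frame must carry `k ≥ log₂(1/ε) − O(1)`
non-Clifford gates (≈ n/2 for the cube S-box state, ≈ n for Haar-typical states) before ANY cut can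
become tame; the free-frame road with an `O(log n)` magic budget therefore dies on the same
witnesses as the free one. Why it might fail: the cleaning count `s_A` becomes a Hilbert–Schmidt
WEIGHT, and the unit-step (first-passage) property of `|A_k| − s_{A_k}` along the chain of cuts is
unproved for non-Clifford frames. -/
def DopedFrameBound : Prop :=
  ∀ (n m D : ℕ) (ε : ℝ) (ψ : QReg n → ℂ), 1 ≤ n → 1 ≤ D → normSq ψ = 1 →
    (∀ S : Fin n → Pauli, S ≠ (fun _ => Pauli.I) →
      ‖star ψ ⬝ᵥ (pauliString S).mulVec ψ‖ ≤ ε) →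
    ∀ U : Matrix (QReg (n + m)) (QReg (n + m)) ℂ, IsSparseFrame (n + m) D U →
      ∃ k ≤ n + m,
        ‖∑ x₁ : QReg (n + m), ∑ x₂ : QReg (n + m), ∑ x₃ : QReg (n + m), ∑ x₄ : QReg (n + m),
          (if (∀ i, k ≤ i.val → x₁ i = x₂ i) ∧ (∀ i, i.val < k → x₂ i = x₃ i) ∧
              (∀ i, k ≤ i.val → x₃ i = x₄ i) ∧ (∀ i, i.val < k → x₄ i = x₁ i) then
            (U.mulVec (tensorVec ψ (zeroState m))) x₁ * star ((U.mulVec (tensorVec ψ (zeroState m))) x₂) *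
              (U.mulVec (tensorVec ψ (zeroState m))) x₃ * star ((U.mulVec (tensorVec ψ (zeroState m))) x₄)
          else 0)‖ ≤ 4 * D * ε

end Summit.QuantumAdvantage.QuantumAdvantage.Cruxes.DeqThesis.Ideator3
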